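import Summits.QuantumFields.YangMills.Theorems.BalabanUVNodesN12NearFlatFederbushFibreTwisted
import Summits.QuantumFields.YangMills.Theorems.BalabanUVNodesN12NearFlatDelta2Letter
import Summits.QuantumFields.YangMills.Theorems.BalabanUVNodesN12GuardedLinAvgRightInverseBj
import Summits.QuantumFields.YangMills.Theorems.BalabanUVNodesN12FlatRightInverseLetterFloor
import Literature.MathematicalPhysics.QuantumFieldTheory.Balaban1983to89.Node00.MultiScaleFibreChartCurvatureUniform
import Literature.MathematicalPhysics.QuantumFieldTheory.Balaban1983to89.Node00.MultiScaleFibreChartLocalityPos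
import Literature.MathematicalPhysics.QuantumFieldTheory.Balaban1983to89.B16Ineq17NearFlatWilsonLettersLocal
import Summits.QuantumFields.YangMills.Theorems.BalabanUVNodesN12NearFlatChartLetterBookkeeping

/-!
# DAG node N12 [B15] — THE CHART LETTER (χ)_N, CORE (`q := ‖·‖` spelled): the chart constants of `…N12NearFlatChartLetter.chartLetter_of_letters` (p630404) with the near-flatness letter on the inputs
# LOCALISED to a bond set `N ⊇ inputsPos 𝐁_k(Z)` (the lane's LOCATED-CIN ruling: the gauge letter (σ)_N of dag-n12-w6's `B15Prop1GaugeLetterGammaZeroPin` delivers `Cin` on `N` only)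

[Balaban1989LargeFieldII] = «[LF-II]», p. 357, (1.7)–(1.9) p. 358, (1.12)–(1.13) p. 359; [Balaban1985Variational] = «[15]», Sect. C (44)–(48) p. 285, (81)–(83) p. 290, (172) p. 305;
[Balaban1988Convergent] = «[III]», (2.2) p. 255 («Γ₀ = Ωᶜ₁»), (2.10)–(2.13) pp. 256–257; [Balaban1985Averaging], Prop. 3 (121)–(125) p. 36; [Balaban1987RG1], (0.4) p. 253.

Cell `pub-ymgap`, HUMAN RULINGS D-0062 ∕ D-0149, width seat `pub-ymgap-dag-n12-w4` generation 4 (INBOX CLAIM-4 ∕ INTENT-6 of 2026-08-28; lane owner dag-n12-c g19 SOCKET OF RECORD v2 l.38237,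
dag-n12-w5 g5 socket text l.38320).  Key K1⁹ `stmt-QuantumFields-27364`, `--kind proof --supports stmt-QuantumFields-27364 --as helper`; count-neutral.  NEW leaf, sibling of p630404 (same
statement as p632050's `chartLetter_of_letters_supNorm` but for the `Cin` premise, now `∀ b ∈ inputs 𝐁_k(Z), b ∈ N → ‖↑(U₀ b) − 1‖ ≤ δin`, the binders `(N) (hN : inputsPos 𝐁_k(Z) ⊆ N)`,
and the binder `h2 : 2 ≤ d` dropped);
CONSUMED BY NAME, nothing modified:
everything p630404 consumes, plus this seat's `Node00.MultiScaleFibreChartLocalityPos` (p637032: the chart depends on `(U₀, W)` only through the level-≥1 data; the Pos proxy pair) and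
`Node00.MultiScaleFibreChartLocalityComponent` (p632873: the level-0 rows of `DΨ(0)` are the identity and those of `D²Ψ(0)` vanish).

THE ARGUMENT.  (1) From C1 and Cin_N with `inputsPos 𝐁_k(Z) ⊆ N ∩ inputs 𝐁_k(Z)`: `U₀` is `δ := max δc δin`-near `1` on `inputsPos 𝐁_k(Z)` and on every bond sourced in `Ω₁(Z)` — NOT
on the far Γ₀ layer, where it is the raw datum.  (2) The Pos proxy pair `(U′, W′)` of `exists_proxyPos` (`U′ = U₀` on `inputsPos`, `1` elsewhere; `W′ = W` at levels ≥ 1) is GLOBALLY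
`δ`-near-flat, lies in its fibre, and has THE SAME CHART: `Ψ_{𝐁,W,U₀} = Ψ_{𝐁,W′,U′}` (`msChart_eq_of_levelPosData`); so every chart-intrinsic row of (χ) — the regularity binders, (δ₂)
(module D at the proxy), the curvature bound, the right inverses, the twist size `‖W_k − 1‖ ≤ K_τ δ` (read through `W′ = M˙^k U′`) — is p630404's row AT THE PROXY, transported by the
equality.  (3) The two rows that read the TRUE `U₀` through the Wilson current `dA(U₀)`: the Lagrange identity `hlam` needs no size; the (μ) row needs `|λ v| ≤ jρ‖v‖` only at
`v = D²Ψ(0)(w,w)`, whose level-0 components VANISH (`fderiv_fderiv_msChart_apply_levelZero`), and for level-0-free `v` EVERY right inverse `R` of `DΨ_{U₀}(0)` places nothing on the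
Γ₀ bonds (`(R v)(c) = v(0,c) = 0` there, `fderiv_msChart_apply_levelZero` + [III] (2.2) `Bj_zero`) — so `R v` is supported on bonds sourced in `Ω₁(Z)`, where the LOCAL current letter
(`letter_j_wilson_local` at `B₀ = {b | b.src ∈ Ω₁(Z)}`) reads exactly C1's plaquettes.  (K) and the Federbush clause are as in p630404.

CONTENTS (namespace `Summit.QuantumFields.YangMills.BalabanUVNodes.N12NearFlatChartLetterN`; theorems only — no `def`, no `instance`, no `sorry`).
* §1 `abs_multiplier_apply_le_of_mem` (the multiplier bound on a set of data), `rightInverse_apply_levelZero` ∕ `rightInverse_apply_eq_zero_of_src_not_mem` (level-0 exactness of any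
  right inverse of `DΨ_{U₀}(0)` at `𝐁_k(Z)`).
* §2 ★★★ `chartLetter_of_letters_supNorm_N` — p632050's `chartLetter_of_letters_supNorm` (= p630404's (χ) with `q := ‖·‖` SPELLED, no `∃ q`) with `Cin` localised to `N ⊇ inputsPos 𝐁_k(Z)`;
  the sockets (`∃ q` form = dag-n12-w5's text, and the `q_η` form) are the sibling `…N12NearFlatChartLetterN`'s one-screen corollaries.
TYPING NOTE.  As p630404: one composition by name whose cumulative unification exceeds the default budget — `set_option maxHeartbeats 400000 in` on the one theorem.

HONEST FRAMING ∕ LOCATED.  Composition by name over landed theorems; every constant a per-height ∕ per-instance EXISTENCE constant, NOT print's volume-uniform ones; `ρc` in `(ℓ²(HS), sup)`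
currency (dag-n10-w1's LOCATED-RHO floor; the `q_η` edition is the sibling `…ChartLetterEta`'s business).  Nothing of Bałaban's (1.7) ∕ (1.12) ∕ Prop. 1 is asserted; count-neutral helper;
N12 NOT discharged; K1⁹ NOT closed; counts unmoved; one finite 𝕋⁴ programme at fixed ε — R4 closes the conditional finite-𝕋⁴ rung `BalabanLadder.UV` only; NOT continuum ∕ OS ∕ mass gap ∕ Clay.
-/

noncomputable section

open scoped BigOperators Matrix.Norms.L2Operator Topology NNReal
open Filter Finset Metric

namespace Summit.QuantumFields.YangMills.BalabanUVNodes.N12NearFlatChartLetterN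

open Literature.MathematicalPhysics.QuantumFieldTheory.Balaban1983to89
open Literature.MathematicalPhysics.QuantumLattice (quatMatrix)
open T4Continuum (T4Family)
open T4HaarSU2ExpChart (imQuat)
open T4AdjointCovarianceUnitary (lieSU)
open T4CubeChartGnomonic (SU2)
open B15DeterminingSets GaugeField
open B14.Eq213DetSet (Bj Bj_of_gt Bj_zero maxDomT)
open B14.Eq213MaximalDomains (side)
open B14.Eq216Concrete (inputs mem_inputs feeds_zero)
open B14.Eq12InteriorLocality (inputsPos mem_inputsPos)
open B15Prop1SliceCoordinates (GaugeSlice ιA)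
open B15Prop1ChartCalculusSU2 (E3)
open B15Prop1ChartSU2 (su2Chart)
open B16Sect1Backgrounds (expMul)
open T4AxialGaugeSmallField (castSite)
open B6TreeGaugePoincare (curl)
open B16Eq18Proof (box)
open BlockAveragingEMLLinearised (linAvg)
open ExpMeanLog (expMeanLogSU deltaSU)
open Literature.MathematicalPhysics.QuantumFieldTheory.BalabanImbrieJaffe1984to88.BIJ85Eq453GaugeField (qsstarGIter0)
open Node00
open Summit.QuantumFields.YangMills.Theorems.BlockAvgCorrector (stokesConst)
open B16Ineq19FlatSliceChart (exists_lieSU2Coord)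
open B16Ineq19NearFlatSliceNorms (opNorm_coe_le_norm_lieSU sum_opNorm_coe_sq_le_sum_norm_sq)
open B16Ineq17NearFlatWilsonLettersLocal (letter_j_wilson_local)
open Summit.QuantumFields.YangMills.BalabanUVNodes.N12NearFlatFederbushFibreTwisted (exists_m_hm_twisted_window_of_isMinimizer_family)
open Summit.QuantumFields.YangMills.BalabanUVNodes.N12NearFlatDelta2Letter (exists_delta2_letter_Bj exists_guard_of_nearFlat exists_rightInverse_fun_of_flat_of_delta2)
open Summit.QuantumFields.YangMills.BalabanUVNodes.N12GuardedLinAvgRightInverseBj (exists_rightInverse_fderiv_msChart_Bj_one)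
open Summit.QuantumFields.YangMills.BalabanUVNodes.N12GuardedChartDerivIterLin (exists_norm_iterM_sub_one_le)
open Summit.QuantumFields.YangMills.BalabanUVNodes.N12FlatRightInverseLetterFloor (norm_sq_lieSU_le_card_mul_opNorm_sq)
open Summit.QuantumFields.YangMills.BalabanUVNodes.N12NearFlatChartLetter (sum_opNorm_sq_le_l2Seminorm_sq l2Seminorm_le_sqrt_card_mul_norm
  sum_opNorm_le_sqrt_card_mul_l2Seminorm l2Seminorm_apply l2Seminorm_le_of_bound_of_support)

variable {F : T4Family}

/-! ## §1  The multiplier bound on a set of data; level-0 exactness of right inverses -/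

section Helpers

/-- **The multiplier bound on a set of data.**  If `φ = λ ∘ L`, `R` is a right inverse of `L`, `|φ(R v)| ≤ j·p(R v)` for the data `v ∈ S` only, and `p(R v) ≤ ρ·q(v)`, then
`|λ v| ≤ j·ρ·q(v)` for every `v ∈ S` (`λ v = φ(R v)`).  The set-restricted form of `B16Ineq17NearFlatOneSidedSeminorm.abs_multiplier_apply_le_seminorm`. [folklore; cite: Balaban1985Variational, p.300 (bookkeeping)] -/
theorem abs_multiplier_apply_le_of_mem {E V : Type*} [NormedAddCommGroup E] [NormedSpace ℝ E] [NormedAddCommGroup V] [NormedSpace ℝ V]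
    (p : Seminorm ℝ E) (q : V → ℝ) (φ : E →L[ℝ] ℝ) (L : E →L[ℝ] V) (S : Set V) {R : V → E}
    (hR : ∀ v, L (R v) = v) {lam : V →L[ℝ] ℝ} (hlam : φ = lam.comp L) {j ρ : ℝ} (hj0 : 0 ≤ j) (hj : ∀ v ∈ S, |φ (R v)| ≤ j * p (R v))
    (hρ : ∀ v, p (R v) ≤ ρ * q v) {v : V} (hv : v ∈ S) : |lam v| ≤ j * ρ * q v := by
  have h1 : lam v = φ (R v) := by rw [hlam, ContinuousLinearMap.comp_apply, hR]
  rw [h1]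
  calc |φ (R v)| ≤ j * p (R v) := hj v hv
    _ ≤ j * (ρ * q v) := mul_le_mul_of_nonneg_left (hρ v) hj0
    _ = j * ρ * q v := by ring

variable {N : ℕ} [NeZero N] {Kt k : ℕ}

/-- **Level-0 exactness of ANY right inverse of `DΨ_{U₀}(0)`**: the level-0 rows of `DΨ_{U₀}(0)` are the identity (`Node00.fderiv_msChart_apply_levelZero`), so a right inverse `R`
places the level-0 datum verbatim on the finest constrained bonds: `(R v)(c) = v(0, c)` for `c ∈ bondsOf (𝐁 0)` — here at a GENERAL fibre label `W` with `U₀` in its fibre (the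
flat ∕ guarded-datum twins with the full interior-or-identity dichotomy are dag-n10-w1's `…N12RightInverseLevelZeroLocality` §3–§4, module H10). [cite: Balaban1988Convergent, (2.10)–(2.11) p.256; Balaban1985Variational, (82)–(83) p.290] -/
theorem rightInverse_apply_levelZero {𝔹 : DetSet (F.P Kt)} {W : MSField (F.P Kt) (SU N)} {U₀ : GaugeField (F.P Kt) 0 (SU N)}
    (hU : AgreeOn 𝔹 (avgFamily (avOfRecord F N Kt) U₀) W) (hΨ : DifferentiableAt ℝ (msChart F N Kt k 𝔹 W U₀) 0)
    {R : (Fin (constrCard 𝔹 k) → lieSU (Fin N)) → PBond (F.P Kt) 0 → lieSU (Fin N)} (hR : ∀ v, fderiv ℝ (msChart F N Kt k 𝔹 W U₀) 0 (R v) = v)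
    (v : Fin (constrCard 𝔹 k) → lieSU (Fin N)) (c : PBond (F.P Kt) 0) (hc : c ∈ bondsOf (𝔹 0)) :
    R v c = v (constrEnum 𝔹 k ⟨⟨0, Nat.succ_pos k⟩, c, hc⟩) := by
  rw [← fderiv_msChart_apply_levelZero hU hΨ c hc (R v), hR]

/-- **At `𝐁_k(Z)` (`0 < k`): for a datum WITHOUT level-0 component, `R v` vanishes at every bond not sourced in `Ω₁(Z)`** — such a bond meets `Γ₀ = Ω₁(Z)ᶜ` ([III] (2.2), `Bj_zero`),
so it is a finest constrained bond, where `R v` is the (zero) level-0 datum. [cite: Balaban1988Convergent, (2.2) p.255, (2.10)–(2.11) p.256] -/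
theorem rightInverse_apply_eq_zero_of_src_not_mem {M₁ : ℕ} {Z : Set (Site (F.P Kt) 0)} (hk0 : 0 < k) {W : MSField (F.P Kt) (SU N)} {U₀ : GaugeField (F.P Kt) 0 (SU N)}
    (hU : AgreeOn (Bj M₁ Z k) (avgFamily (avOfRecord F N Kt) U₀) W) (hΨ : DifferentiableAt ℝ (msChart F N Kt k (Bj M₁ Z k) W U₀) 0)
    {R : (Fin (constrCard (Bj M₁ Z k) k) → lieSU (Fin N)) → PBond (F.P Kt) 0 → lieSU (Fin N)} (hR : ∀ v, fderiv ℝ (msChart F N Kt k (Bj M₁ Z k) W U₀) 0 (R v) = v)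
    {v : Fin (constrCard (Bj M₁ Z k) k) → lieSU (Fin N)} (hv : ∀ c (hc : c ∈ bondsOf (Bj M₁ Z k 0)), v (constrEnum (Bj M₁ Z k) k ⟨⟨0, Nat.succ_pos k⟩, c, hc⟩) = 0)
    (b : PBond (F.P Kt) 0) (hb : b ∉ {b : PBond (F.P Kt) 0 | b.src ∈ maxDomT M₁ Z 1}) : R v b = 0 := by
  have hb0 : b ∈ bondsOf (Bj M₁ Z k 0) := by
    rw [Bj_zero hk0]
    exact Or.inl hb
  rw [rightInverse_apply_levelZero hU hΨ hR v b hb0, hv b hb0]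

end Helpers

/-! ## §2  ★★★ The chart letter (χ)_N, assembled -/

section Main

set_option maxHeartbeats 400000 in
/-- ★★★ **THE CHART LETTER (χ)_N, CORE — p632050's `chartLetter_of_letters_supNorm` (p630404's (χ) with `q := ‖·‖` spelled) WITH THE INPUTS' NEAR-FLATNESS LOCALISED TO `N ⊇ inputsPos 𝐁_k(Z)`.**  Same instance-geometry letters (but `2 ≤ d`, unused here and dropped), same
shape of constants (`ρ⋆ > 0`, `Cμ Cρ C₂ Cτ ≥ 0`, per height ∕ instance), same conclusion TEXT as (χ) with `γ₀ := (L^d)^k∕(L²L²)^k`, `μc := Cμ·max δc δin`, `ρc := Cρ`, `δ₂c := C₂·max δc δin`,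
`Kc := 12𝓐₀∕R·√#{b | b.src ∈ Ω₁(Z)}`, `τc := γ₀·16(d+1)·(Cτ·max δc δin)`; the ONLY change is the premise `Cin`, now `∀ b ∈ inputs 𝐁_k(Z), b ∈ N → ‖↑(U₀ b) − 1‖ ≤ δin`, under the binders
`(N) (hN : inputsPos 𝐁_k(Z) ⊆ N)`.  Inside: the Pos proxy pair of `Node00.exists_proxyPos` carries every chart-intrinsic row (the chart at `(U₀, W)` IS the chart at the proxy,
`Node00.msChart_eq_of_levelPosData`); the (μ) row reads the true `U₀` only through the local current letter at `B₀ = {b | b.src ∈ Ω₁(Z)}` (C1's plaquettes), legitimate because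
`D²Ψ(0)(w,w)` has no level-0 component and right inverses place nothing on Γ₀ for such data (§1).
[cite: Balaban1989LargeFieldII, p.357, (1.7)–(1.9) p.358, (1.12)–(1.13) p.359; Balaban1985Variational, Sect. C (44)–(48) p.285, (81)–(83) p.290, (172) p.305; Balaban1988Convergent, (2.2) p.255, (2.10)–(2.13) pp.256–257; Balaban1985Averaging, Prop. 3 (121)–(125) p.36] -/
theorem chartLetter_of_letters_supNorm_N (ν : Node00.Stage7Numerics) (Kt : ℕ) (h0 : 0 < (F.P Kt).d)
    {k : ℕ} (hk0 : 0 < k) (hk : k ≤ (F.P Kt).m + (F.P Kt).K)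
    (Z Λ : Set (Site (F.P Kt) 0)) (T : Finset (PBond (F.P Kt) k)) (lo hi : Fin (F.P Kt).d → ℤ)
    -- instance geometry letters (displayed)
    (hM2 : 2 ≤ ν.M₁) (hdiv : side (F.P Kt).L ν.M₁ k ∣ (F.P Kt).sitesPerDir 0)
    (hbox : ∀ κ, (((hi κ - lo κ + 1).toNat + 3 : ℕ) : ℤ) ≤ (F.P Kt).sitesPerDir k)
    (hΩw : ∀ (ν' : Fin (F.P Kt).d), ∀ z ∈ box (fun κ => (hi κ - lo κ + 1).toNat + 3) (fun κ => lo κ - 2),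
      (castSite z : Site (F.P Kt) k) ∈ pts k (maxDomT ν.M₁ Z k) ∧ (castSite z : Site (F.P Kt) k).shift ⟨0, h0⟩ ∈ pts k (maxDomT ν.M₁ Z k) ∧
        (castSite z : Site (F.P Kt) k).shift ν' ∈ pts k (maxDomT ν.M₁ Z k))
    -- the localised near-flatness region of the gauge letter (σ)_N: any bond set containing the towers of the constrained bonds of levels ≥ 1
    (N : Set (PBond (F.P Kt) 0)) (hN : inputsPos (Bj ν.M₁ Z k) ⊆ N) :
    ∃ ρs Cμ Cρ C₂ Cτ : ℝ, 0 < ρs ∧ 0 ≤ Cμ ∧ 0 ≤ Cρ ∧ 0 ≤ C₂ ∧ 0 ≤ Cτ ∧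
      ∀ (ext : GaugeField (F.P Kt) k SU2 → GaugeField (F.P Kt) k SU2) (Vk : GaugeField (F.P Kt) k SU2) {R 𝓐₀ : ℝ}, 0 < R → 0 ≤ 𝓐₀ →
      ∀ {δc δin : ℝ}, 0 ≤ δc → 0 ≤ δin → 0 < max δc δin → max δc δin ≤ ρs →
      ∀ (U₀ : GaugeField (F.P Kt) 0 SU2) (Xf : GaugeSlice (pts k Λ) T E3 → PBond (F.P Kt) 0 → lieSU (Fin 2)),
      IsMinimizer (Node00.avOfRecord F 2 Kt) (Node00.regMSCoPOfRecord F 2 ν Kt k (maxDomT ν.M₁ Z)) (Bj ν.M₁ Z k)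
        (avgFamily (Node00.avOfRecord F 2 Kt) (qsstarGIter0 k (ext Vk))) U₀ →
      (∀ p : Plaq (F.P Kt) 0, ((⟨p.src, p.μ⟩ : PBond (F.P Kt) 0) ∈ {b : PBond (F.P Kt) 0 | b.src ∈ maxDomT ν.M₁ Z 1} ∨
          (⟨p.src.shift p.μ, p.ν⟩ : PBond (F.P Kt) 0) ∈ {b : PBond (F.P Kt) 0 | b.src ∈ maxDomT ν.M₁ Z 1} ∨
          (⟨p.src.shift p.ν, p.μ⟩ : PBond (F.P Kt) 0) ∈ {b : PBond (F.P Kt) 0 | b.src ∈ maxDomT ν.M₁ Z 1} ∨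
          (⟨p.src, p.ν⟩ : PBond (F.P Kt) 0) ∈ {b : PBond (F.P Kt) 0 | b.src ∈ maxDomT ν.M₁ Z 1}) →
        ‖((U₀ ⟨p.src, p.μ⟩ : SU2) : Matrix (Fin 2) (Fin 2) ℂ) - 1‖ ≤ δc ∧ ‖((U₀ ⟨p.src.shift p.μ, p.ν⟩ : SU2) : Matrix (Fin 2) (Fin 2) ℂ) - 1‖ ≤ δc ∧
          ‖((U₀ ⟨p.src.shift p.ν, p.μ⟩ : SU2) : Matrix (Fin 2) (Fin 2) ℂ) - 1‖ ≤ δc ∧ ‖((U₀ ⟨p.src, p.ν⟩ : SU2) : Matrix (Fin 2) (Fin 2) ℂ) - 1‖ ≤ δc) →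
      (∀ b ∈ inputs (Bj ν.M₁ Z k), b ∈ N → ‖((U₀ b : SU2) : Matrix (Fin 2) (Fin 2) ℂ) - 1‖ ≤ δin) →
      Xf 0 = 0 → ContDiffAt ℝ 2 Xf 0 →
      (∀ᶠ Y in 𝓝 (0 : GaugeSlice (pts k Λ) T E3),
        IsMinimizer (Node00.avOfRecord F 2 Kt) (Node00.regMSCoPOfRecord F 2 ν Kt k (maxDomT ν.M₁ Z)) (Bj ν.M₁ Z k)
          (avgFamily (Node00.avOfRecord F 2 Kt) (qsstarGIter0 k (expMul su2Chart (ιA (pts k Λ) T Y) (ext Vk)))) (expChart U₀ (Xf Y))) →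
      (∀ (X : GaugeSlice (pts k Λ) T E3) (b : PBond (F.P Kt) 0),
        ‖((fderiv ℝ Xf 0 X b : lieSU (Fin 2)) : Matrix (Fin 2) (Fin 2) ℂ)‖ ≤ 8 * 𝓐₀ / R * ‖X‖ ∧ ‖fderiv ℝ Xf 0 X b‖ ≤ 12 * 𝓐₀ / R * ‖X‖) →
      (∀ (X : GaugeSlice (pts k Λ) T E3) (b : PBond (F.P Kt) 0), b.src ∉ maxDomT ν.M₁ Z 1 → fderiv ℝ Xf 0 X b = 0) →
      ∃ (Ψ₂ : (PBond (F.P Kt) 0 → lieSU (Fin 2)) →L[ℝ] (PBond (F.P Kt) 0 → lieSU (Fin 2)) →L[ℝ] (Fin (constrCard (Bj ν.M₁ Z k) k) → lieSU (Fin 2)))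
        (lam : (Fin (constrCard (Bj ν.M₁ Z k) k) → lieSU (Fin 2)) →L[ℝ] ℝ)
        (p : Seminorm ℝ (PBond (F.P Kt) 0 → lieSU (Fin 2)))
        (Lf : (PBond (F.P Kt) 0 → lieSU (Fin 2)) →L[ℝ] (Fin (constrCard (Bj ν.M₁ Z k) k) → lieSU (Fin 2)))
        (Rf : (Fin (constrCard (Bj ν.M₁ Z k) k) → lieSU (Fin 2)) → PBond (F.P Kt) 0 → lieSU (Fin 2)),
        HasFDerivAt (fun Y => fderiv ℝ (msChart F 2 Kt k (Bj ν.M₁ Z k) (avgFamily (Node00.avOfRecord F 2 Kt) (qsstarGIter0 k (ext Vk))) U₀) Y) Ψ₂ 0 ∧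
        (∀ᶠ Y in 𝓝 (0 : PBond (F.P Kt) 0 → lieSU (Fin 2)),
          DifferentiableAt ℝ (msChart F 2 Kt k (Bj ν.M₁ Z k) (avgFamily (Node00.avOfRecord F 2 Kt) (qsstarGIter0 k (ext Vk))) U₀) Y) ∧
        fderiv ℝ (fun Y : PBond (F.P Kt) 0 → lieSU (Fin 2) => wilsonAction4 (expChart U₀ Y)) 0 =
          lam.comp (fderiv ℝ (msChart F 2 Kt k (Bj ν.M₁ Z k) (avgFamily (Node00.avOfRecord F 2 Kt) (qsstarGIter0 k (ext Vk))) U₀) 0) ∧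
        (∀ Y : PBond (F.P Kt) 0 → lieSU (Fin 2), ∑ b, ‖(Y b : Matrix (Fin 2) (Fin 2) ℂ)‖ ^ 2 ≤ p Y ^ 2) ∧
        (∀ v, Lf (Rf v) = v) ∧ (∀ v, p (Rf v) ≤ Cρ * ‖v‖) ∧
        ∀ X : GaugeSlice (pts k Λ) T E3,
          ‖fderiv ℝ (msChart F 2 Kt k (Bj ν.M₁ Z k) (avgFamily (Node00.avOfRecord F 2 Kt) (qsstarGIter0 k (ext Vk))) U₀) 0 (fderiv ℝ Xf 0 X)
              - Lf (fderiv ℝ Xf 0 X)‖ ≤ (C₂ * max δc δin) * p (fderiv ℝ Xf 0 X) ∧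
          lam (Ψ₂ (fderiv ℝ Xf 0 X) (fderiv ℝ Xf 0 X)) ≤ (Cμ * max δc δin) * p (fderiv ℝ Xf 0 X) ^ 2 ∧
          p (fderiv ℝ Xf 0 X) ≤ (12 * 𝓐₀ / R * Real.sqrt (Nat.card {b : PBond (F.P Kt) 0 // b.src ∈ maxDomT ν.M₁ Z 1})) * ‖X‖ ∧
          ∃ m : ℝ, (∀ w', Lf w' = fderiv ℝ (msChart F 2 Kt k (Bj ν.M₁ Z k) (avgFamily (Node00.avOfRecord F 2 Kt) (qsstarGIter0 k (ext Vk))) U₀) 0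
                (fderiv ℝ Xf 0 X) →
              m ≤ fderiv ℝ (fun Y => fderiv ℝ (fun Y : PBond (F.P Kt) 0 → lieSU (Fin 2) => wilsonAction4 (expChart (1 : GaugeField (F.P Kt) 0 SU2) Y)) Y) 0 w' w') ∧
            (((F.P Kt).L : ℝ) ^ (F.P Kt).d) ^ k / ((((F.P Kt).L : ℝ)) ^ 2 * ((F.P Kt).L : ℝ) ^ 2) ^ k *
                (∑ z ∈ box (fun κ => (hi κ - lo κ + 1).toNat + 3) (fun κ => lo κ - 2), ∑ μ : Fin (F.P Kt).d, ∑ a : Fin 3,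
                  curl (fun b => ιA (pts k Λ) T X (⟨castSite b.1, b.2⟩ : PBond (F.P Kt) k) a) z ⟨0, h0⟩ μ ^ 2)
              - ((((F.P Kt).L : ℝ) ^ (F.P Kt).d) ^ k / ((((F.P Kt).L : ℝ)) ^ 2 * ((F.P Kt).L : ℝ) ^ 2) ^ k
                  * (16 * (((F.P Kt).d : ℝ) + 1) * (Cτ * max δc δin))) * ‖X‖ ^ 2 ≤ m := by
  -- ### the auxiliary `linAvg` iterate of the (δ₂) module
  let Q : (i : ℕ) → (PBond (F.P Kt) 0 → Matrix (Fin 2) (Fin 2) ℂ) → PBond (F.P Kt) i → Matrix (Fin 2) (Fin 2) ℂ := fun i =>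
    Nat.rec (motive := fun i => (PBond (F.P Kt) 0 → Matrix (Fin 2) (Fin 2) ℂ) → PBond (F.P Kt) i → Matrix (Fin 2) (Fin 2) ℂ)
      (fun Y => Y) (fun _ q Y c => linAvg (q Y) c) i
  have hQ0 : ∀ Y, Q 0 Y = Y := fun Y => rfl
  have hQs : ∀ (i : ℕ) (Y : PBond (F.P Kt) 0 → Matrix (Fin 2) (Fin 2) ℂ) (c : PBond (F.P Kt) (i + 1)), Q (i + 1) Y c = linAvg (Q i Y) c :=
    fun i Y c => rfl
  -- ### the junction's seminorm `p := bond-ℓ²(HS)` and its letters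
  let p : Seminorm ℝ (PBond (F.P Kt) 0 → lieSU (Fin 2)) :=
    (normSeminorm ℝ (PiLp 2 (fun _ : PBond (F.P Kt) 0 => lieSU (Fin 2)))).comp (WithLp.linearEquiv 2 ℝ (PBond (F.P Kt) 0 → lieSU (Fin 2))).symm.toLinearMap
  have hp : ∀ Y : PBond (F.P Kt) 0 → lieSU (Fin 2), ∑ b, ‖(Y b : Matrix (Fin 2) (Fin 2) ℂ)‖ ^ 2 ≤ p Y ^ 2 := fun Y => sum_opNorm_sq_le_l2Seminorm_sq Y
  let n : ℝ := Real.sqrt (Fintype.card (PBond (F.P Kt) 0))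
  have hn0 : 0 ≤ n := Real.sqrt_nonneg _
  have hpl1 : ∀ Y : PBond (F.P Kt) 0 → lieSU (Fin 2), ∑ b, ‖(Y b : Matrix (Fin 2) (Fin 2) ℂ)‖ ≤ n * p Y := fun Y => sum_opNorm_le_sqrt_card_mul_l2Seminorm Y
  -- the `ℓ¹`-dominating seminorm of the current letter: `p₁ := √#bonds • p`
  let p₁ : Seminorm ℝ (PBond (F.P Kt) 0 → lieSU (Fin 2)) :=
    p.comp (n • (LinearMap.id : (PBond (F.P Kt) 0 → lieSU (Fin 2)) →ₗ[ℝ] (PBond (F.P Kt) 0 → lieSU (Fin 2))))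
  have hp₁_apply : ∀ Y : PBond (F.P Kt) 0 → lieSU (Fin 2), p₁ Y = n * p Y := fun Y => by
    show p ((n • (LinearMap.id : (PBond (F.P Kt) 0 → lieSU (Fin 2)) →ₗ[ℝ] (PBond (F.P Kt) 0 → lieSU (Fin 2)))) Y) = n * p Y
    rw [LinearMap.smul_apply, LinearMap.id_apply, map_smul_eq_mul, Real.norm_of_nonneg hn0]
  have hp₁ : ∀ Y : PBond (F.P Kt) 0 → lieSU (Fin 2), ∑ b, ‖(Y b : Matrix (Fin 2) (Fin 2) ℂ)‖ ≤ p₁ Y := fun Y => by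
    rw [hp₁_apply]; exact hpl1 Y
  -- ### the per-height ∕ per-instance constant packages, BY NAME
  obtain ⟨C, ρD, hC, hρD, hD⟩ := exists_delta2_letter_Bj (F := F) (N := 2) (K := Kt) k ν.M₁ Z Q hQ0 hQs p hp
  obtain ⟨t₀, ρg, ht₀, hst, hρg, hguard⟩ := exists_guard_of_nearFlat (F := F) (N := 2) Kt k
  -- the uniform chart-curvature bound in `p`-currency, with the `SmallBelow` guard from near-flatness
  obtain ⟨M₂, ρμ, hM₂, hρμ, hsbU, hcs⟩ := exists_uniform_chartCurvature_sq_bound_seminorm (F := F) (N := 2) (K := Kt) k p hp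
  -- dag-n10-w1's flat right inverse at `𝐁_k(Z)` (J-C's `R_f`), with its operator norm as the letter in `p`-currency
  obtain ⟨Hf, B, hB0, hHf, hHfB⟩ := exists_rightInverse_fderiv_msChart_Bj_one (F := F) (N := 2) (K := Kt) (k := k) hM2 hk (Z := Z) hdiv
  let ρf : ℝ := n * Real.sqrt 2 * B
  have hρf0 : 0 ≤ ρf := by positivity
  have hρf : ∀ v, p (Hf v) ≤ ρf * ‖v‖ := fun v => by
    have hterm : ∀ b, ‖Hf v b‖ ^ 2 ≤ 2 * (B * ‖v‖) ^ 2 := fun b => by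
      have h1 := norm_sq_lieSU_le_card_mul_opNorm_sq (Hf v b)
      have h2 : ‖((Hf v b : lieSU (Fin 2)) : Matrix (Fin 2) (Fin 2) ℂ)‖ ≤ B * ‖v‖ :=
        (norm_le_pi_norm (fun b => ((Hf v b : lieSU (Fin 2)) : Matrix (Fin 2) (Fin 2) ℂ)) b).trans (hHfB v)
      have h3 := pow_le_pow_left₀ (norm_nonneg _) h2 2
      calc ‖Hf v b‖ ^ 2 ≤ ((2 : ℕ) : ℝ) * ‖((Hf v b : lieSU (Fin 2)) : Matrix (Fin 2) (Fin 2) ℂ)‖ ^ 2 := h1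
        _ ≤ 2 * (B * ‖v‖) ^ 2 := by rw [Nat.cast_ofNat]; exact mul_le_mul_of_nonneg_left h3 (by norm_num)
    have e : p (Hf v) = Real.sqrt (∑ b, ‖Hf v b‖ ^ 2) := l2Seminorm_apply _
    rw [e]
    calc Real.sqrt (∑ b, ‖Hf v b‖ ^ 2) ≤ Real.sqrt (∑ _b : PBond (F.P Kt) 0, 2 * (B * ‖v‖) ^ 2) :=
          Real.sqrt_le_sqrt (Finset.sum_le_sum fun b _ => hterm b)
      _ = Real.sqrt ((Fintype.card (PBond (F.P Kt) 0) : ℝ) * (Real.sqrt 2 * (B * ‖v‖)) ^ 2) := by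
          congr 1
          rw [Finset.sum_const, Finset.card_univ, nsmul_eq_mul, mul_pow (Real.sqrt 2) (B * ‖v‖) 2,
            Real.sq_sqrt (by norm_num : (0 : ℝ) ≤ 2)]
      _ = n * (Real.sqrt 2 * (B * ‖v‖)) := by rw [Real.sqrt_mul (Nat.cast_nonneg _), Real.sqrt_sq (by positivity)]
      _ = ρf * ‖v‖ := by simp only [ρf]; ring
  -- the averages stay close: `‖Ū^k(U) − 1‖ ≤ K_τ‖↑U − 1‖`
  obtain ⟨Kτ, ρτ, hKτ, hρτ, hτW⟩ := exists_norm_iterM_sub_one_le (P := F.P Kt) (N := 2) k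
  -- ### the constants
  refine ⟨min (min (ρD / 2) ρg) (min (min ρμ (ρτ / 2)) (1 / (2 * (C * ρf + 1)))),
    32 * (((F.P Kt).d : ℝ) - 1) * n * ρf * M₂, ρf, C, 2 * (Kτ + 1),
    by positivity, ?_, hρf0, hC, by positivity, ?_⟩
  · have hd1 : (1 : ℝ) ≤ ((F.P Kt).d : ℝ) := by exact_mod_cast h0
    have : 0 ≤ ((F.P Kt).d : ℝ) - 1 := by linarith
    positivity
  intro ext Vk R 𝓐₀ hR h𝓐₀ δc δin hδc0 hδin0 hδpos hδρ U₀ Xf hmin0 hC1 hCin hX₀ hXc hmin hKb hsupp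
  -- ### radii
  let δ : ℝ := max δc δin
  have hδ0 : 0 ≤ δ := hδpos.le
  have hδD : δ < ρD := by
    have : δ ≤ ρD / 2 := hδρ.trans ((min_le_left _ _).trans (min_le_left _ _))
    linarith
  have hδg : δ ≤ ρg := hδρ.trans ((min_le_left _ _).trans (min_le_right _ _))
  have hδμ : δ ≤ ρμ := hδρ.trans ((min_le_right _ _).trans ((min_le_left _ _).trans (min_le_left _ _)))
  have hδτ : δ < ρτ := by
    have : δ ≤ ρτ / 2 := hδρ.trans ((min_le_right _ _).trans ((min_le_left _ _).trans (min_le_right _ _)))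
    linarith
  have hδN : δ ≤ 1 / (2 * (C * ρf + 1)) := hδρ.trans ((min_le_right _ _).trans (min_le_right _ _))
  -- ### (1) WHERE `U₀` IS `δ`-NEAR-FLAT: on `inputsPos 𝐁_k(Z)` (Cin_N with `hN`; `inputsPos ⊆ inputs`) and on C1's plaquettes
  have hUpos : ∀ b ∈ inputsPos (Bj ν.M₁ Z k), ‖((U₀ b : SU2) : Matrix (Fin 2) (Fin 2) ℂ) - 1‖ ≤ δ := fun b hb => by
    obtain ⟨j, c, hc, hbc⟩ := mem_inputsPos.1 hb
    exact (hCin b (mem_inputs.2 ⟨j + 1, c, hc, hbc⟩) (hN hb)).trans (le_max_right _ _)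
  have hC1δ : ∀ q : Plaq (F.P Kt) 0, ((⟨q.src, q.μ⟩ : PBond (F.P Kt) 0) ∈ {b : PBond (F.P Kt) 0 | b.src ∈ maxDomT ν.M₁ Z 1} ∨
      (⟨q.src.shift q.μ, q.ν⟩ : PBond (F.P Kt) 0) ∈ {b : PBond (F.P Kt) 0 | b.src ∈ maxDomT ν.M₁ Z 1} ∨
      (⟨q.src.shift q.ν, q.μ⟩ : PBond (F.P Kt) 0) ∈ {b : PBond (F.P Kt) 0 | b.src ∈ maxDomT ν.M₁ Z 1} ∨
      (⟨q.src, q.ν⟩ : PBond (F.P Kt) 0) ∈ {b : PBond (F.P Kt) 0 | b.src ∈ maxDomT ν.M₁ Z 1}) →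
      ‖((U₀ ⟨q.src, q.μ⟩ : SU2) : Matrix (Fin 2) (Fin 2) ℂ) - 1‖ ≤ δ ∧ ‖((U₀ ⟨q.src.shift q.μ, q.ν⟩ : SU2) : Matrix (Fin 2) (Fin 2) ℂ) - 1‖ ≤ δ ∧
        ‖((U₀ ⟨q.src.shift q.ν, q.μ⟩ : SU2) : Matrix (Fin 2) (Fin 2) ℂ) - 1‖ ≤ δ ∧ ‖((U₀ ⟨q.src, q.ν⟩ : SU2) : Matrix (Fin 2) (Fin 2) ℂ) - 1‖ ≤ δ := fun q hq =>
    ⟨(hC1 q hq).1.trans (le_max_left _ _), (hC1 q hq).2.1.trans (le_max_left _ _), (hC1 q hq).2.2.1.trans (le_max_left _ _),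
      (hC1 q hq).2.2.2.trans (le_max_left _ _)⟩
  -- ### (2) THE POS PROXY PAIR: globally `δ`-near-flat, in its fibre, with THE SAME CHART
  have h𝔹 : ∀ j', k < j' → Bj ν.M₁ Z k j' = ∅ := fun _ hj' => Bj_of_gt hj'
  have hUfib : AgreeOn (Bj ν.M₁ Z k) (avgFamily (avOfRecord F 2 Kt) U₀) (avgFamily (avOfRecord F 2 Kt) (qsstarGIter0 k (ext Vk))) := hmin0.2.1
  obtain ⟨U', W', hin', hU', hW', hU'fib⟩ :=
    exists_proxyPos hk h𝔹 U₀ (avgFamily (avOfRecord F 2 Kt) (qsstarGIter0 k (ext Vk))) hUfib (inputsPos (Bj ν.M₁ Z k)) subset_rfl hδ0 hUpos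
  have hsb' : SmallBelow (avOfRecord F 2 Kt) k U' := hsbU U' (hU'.trans hδμ)
  have heq : msChart F 2 Kt k (Bj ν.M₁ Z k) (avgFamily (avOfRecord F 2 Kt) (qsstarGIter0 k (ext Vk))) U₀ = msChart F 2 Kt k (Bj ν.M₁ Z k) W' U' :=
    msChart_eq_of_levelPosData hk hin' hUfib hU'fib hW'
  have hcrit : IsCritOnFibre F 2 Kt (Bj ν.M₁ Z k) (avgFamily (avOfRecord F 2 Kt) (qsstarGIter0 k (ext Vk))) U₀ :=
    isCritOnFibre_of_isMinimizer_regMSCoPOfRecord ν (maxDomT ν.M₁ Z) hmin0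
  have hgd' : ∀ i, i < k → PlaqSmall t₀ (Averaging.iter (avOfRecord F 2 Kt) i U') := fun i hi => hguard U' (hU'.trans hδg) i hi.le
  -- ### the chart's regularity binders at `U₀`, through the proxy
  obtain ⟨hΨs, hΨ₂, hΨd⟩ := regularity_triple_msChart_of_proxyPos hk hin' hUfib hU'fib hW' hsb'
  have hΨ : DifferentiableAt ℝ (msChart F 2 Kt k (Bj ν.M₁ Z k) (avgFamily (avOfRecord F 2 Kt) (qsstarGIter0 k (ext Vk))) U₀) 0 :=
    hΨs.hasFDerivAt.differentiableAt
  -- ### (δ₂) in the junction's currency: module D AT THE PROXY, transported by `heq`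
  have hδ₂w : ∀ w, ‖fderiv ℝ (msChart F 2 Kt k (Bj ν.M₁ Z k) (avgFamily (avOfRecord F 2 Kt) (qsstarGIter0 k (ext Vk))) U₀) 0 w
      - fderiv ℝ (msChart F 2 Kt k (Bj ν.M₁ Z k) (avgFamily (avOfRecord F 2 Kt) (1 : GaugeField (F.P Kt) 0 SU2)) (1 : GaugeField (F.P Kt) 0 SU2)) 0 w‖ ≤ C * δ * p w := by
    intro w
    rw [heq]
    refine (hD ht₀ hst U' W' hgd' (lt_of_le_of_lt hU' hδD) hU'fib w).trans ?_
    exact mul_le_mul_of_nonneg_right (mul_le_mul_of_nonneg_left hU' hC) (apply_nonneg p w)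
  -- the curvature bound at `U₀`, through the proxy
  have hN2 : ((2 : ℕ) : ℝ) = 2 := Nat.cast_ofNat
  have hcurv : ∀ w, ‖fderiv ℝ (fderiv ℝ (msChart F 2 Kt k (Bj ν.M₁ Z k) (avgFamily (avOfRecord F 2 Kt) (qsstarGIter0 k (ext Vk))) U₀)) 0 w w‖ ≤ 2 * M₂ * p w ^ 2 := by
    intro w
    have h := hcs (Bj ν.M₁ Z k) W' U' (hU'.trans hδμ) hU'fib w
    rw [hN2] at h
    rw [heq]
    exact h
  -- ### the Neumann right inverse of `DΨ(0)` (for `hlam` ∕ (μ)), with letter `2ρf`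
  have hδ₂0 : 0 ≤ C * δ := by positivity
  have hhalf : C * δ * ρf ≤ 1 / 2 := by
    have hpos : 0 < 2 * (C * ρf + 1) := by positivity
    have h1 : δ * (2 * (C * ρf + 1)) ≤ 1 := by
      calc δ * (2 * (C * ρf + 1)) ≤ 1 / (2 * (C * ρf + 1)) * (2 * (C * ρf + 1)) := mul_le_mul_of_nonneg_right hδN hpos.le
        _ = 1 := by field_simp
    have e : C * δ * ρf = (δ * (2 * (C * ρf + 1)) - 2 * δ) / 2 := by ring
    rw [e]
    linarith
  have hsmall : C * δ * ρf < 1 := by linarith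
  obtain ⟨Rn, hRn, hρRn⟩ := exists_rightInverse_fun_of_flat_of_delta2 p
    ((fderiv ℝ (msChart F 2 Kt k (Bj ν.M₁ Z k) (avgFamily (avOfRecord F 2 Kt) (qsstarGIter0 k (ext Vk))) U₀) 0).toLinearMap)
    ((fderiv ℝ (msChart F 2 Kt k (Bj ν.M₁ Z k) (avgFamily (avOfRecord F 2 Kt) (1 : GaugeField (F.P Kt) 0 SU2)) (1 : GaugeField (F.P Kt) 0 SU2)) 0).toLinearMap)
    Hf hHf hρf0 hδ₂0 hρf (fun w => hδ₂w w) hsmall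
  have hRn' : ∀ v, fderiv ℝ (msChart F 2 Kt k (Bj ν.M₁ Z k) (avgFamily (avOfRecord F 2 Kt) (qsstarGIter0 k (ext Vk))) U₀) 0 (Rn v) = v := fun v => hRn v
  have hρR2 : ∀ v, p (Rn v) ≤ 2 * ρf * ‖v‖ := fun v => by
    refine (hρRn v).trans (mul_le_mul_of_nonneg_right ?_ (norm_nonneg v))
    have h1 : 0 < 1 - C * δ * ρf := by linarith
    rw [div_le_iff₀ h1]
    have h2 : 0 ≤ ρf * (1 - 2 * (C * δ * ρf)) := mul_nonneg hρf0 (by linarith)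
    calc ρf = 2 * ρf * (1 - C * δ * ρf) - ρf * (1 - 2 * (C * δ * ρf)) := by ring
      _ ≤ 2 * ρf * (1 - C * δ * ρf) := sub_le_self _ h2
  -- ### (3) THE TRUE `U₀` THROUGH THE WILSON CURRENT: the LOCAL current letter at `B₀ = {b | b.src ∈ Ω₁(Z)}` (C1's plaquettes), `j = 8(d−1)·δ·√#bonds`
  have hj : ∀ x : PBond (F.P Kt) 0 → lieSU (Fin 2), (∀ b ∉ {b : PBond (F.P Kt) 0 | b.src ∈ maxDomT ν.M₁ Z 1}, x b = 0) →
      |fderiv ℝ (fun Y : PBond (F.P Kt) 0 → lieSU (Fin 2) => wilsonAction4 (expChart U₀ Y)) 0 x| ≤ (8 * (((F.P Kt).d : ℝ) - 1) * δ * n) * p x := by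
    intro x hx
    have h := letter_j_wilson_local U₀ {b : PBond (F.P Kt) 0 | b.src ∈ maxDomT ν.M₁ Z 1} hδ0 hC1δ p₁ hp₁ x hx
    rw [hp₁_apply x] at h
    linarith
  have hd1 : 0 ≤ ((F.P Kt).d : ℝ) - 1 := by
    have : (1 : ℝ) ≤ ((F.P Kt).d : ℝ) := by exact_mod_cast h0
    linarith
  have hj0 : 0 ≤ 8 * (((F.P Kt).d : ℝ) - 1) * δ * n := by positivity
  -- ### the multiplier (Lagrange identity through the proxy's `IsFibreChartNear`) and its bound ON LEVEL-0-FREE DATA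
  obtain ⟨lam, hlam⟩ := exists_lam_msChart_of_surjective_of_proxyPos hk h𝔹 hin' hUfib hU'fib hW' hsb' (fun v => ⟨Rn v, hRn' v⟩) hcrit
  have hlamv : ∀ v : Fin (constrCard (Bj ν.M₁ Z k) k) → lieSU (Fin 2),
      (∀ c (hc : c ∈ bondsOf (Bj ν.M₁ Z k 0)), v (constrEnum (Bj ν.M₁ Z k) k ⟨⟨0, Nat.succ_pos k⟩, c, hc⟩) = 0) →
      |lam v| ≤ (8 * (((F.P Kt).d : ℝ) - 1) * δ * n) * (2 * ρf) * ‖v‖ := fun v hv =>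
    abs_multiplier_apply_le_of_mem p (fun v => ‖v‖) _ _
      {v : Fin (constrCard (Bj ν.M₁ Z k) k) → lieSU (Fin 2) |
        ∀ c (hc : c ∈ bondsOf (Bj ν.M₁ Z k 0)), v (constrEnum (Bj ν.M₁ Z k) k ⟨⟨0, Nat.succ_pos k⟩, c, hc⟩) = 0} hRn' hlam hj0
      (fun v hv => hj (Rn v) (rightInverse_apply_eq_zero_of_src_not_mem hk0 hUfib hΨ hRn' hv)) hρR2 hv
  -- ### the twist size: the datum's top constrained averages are `Ū^k(U′)` (levels ≥ 1 of `W` are those of `W′ = M˙U′`), within `K_τ·δ` of `1`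
  have hiter : ‖(iterM k : (PBond (F.P Kt) 0 → Matrix (Fin 2) (Fin 2) ℂ) → PBond (F.P Kt) k → Matrix (Fin 2) (Fin 2) ℂ) (coeField U') - 1‖ ≤ Kτ * δ :=
    (hτW U' (lt_of_le_of_lt hU' hδτ)).trans (mul_le_mul_of_nonneg_left hU' hKτ)
  have hcoe : coeField (Averaging.iter (avOfRecord F 2 Kt) k U') = iterM k (coeField U') := coeField_iter_eq_iterM k hsb'
  have hW : ∀ c ∈ bondsOf (Bj ν.M₁ Z k k),
      ‖((avgFamily (avOfRecord F 2 Kt) (qsstarGIter0 k (ext Vk)) k c : SU 2) : Matrix (Fin 2) (Fin 2) ℂ) - 1‖ ≤ (2 * (Kτ + 1) * δ) / 2 := by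
    intro c hc
    rw [← hW' k hk0 c hc, ← hU'fib k c hc]
    have e : ((avgFamily (avOfRecord F 2 Kt) U' k c : SU 2) : Matrix (Fin 2) (Fin 2) ℂ) - 1
        = ((iterM k : (PBond (F.P Kt) 0 → Matrix (Fin 2) (Fin 2) ℂ) → PBond (F.P Kt) k → Matrix (Fin 2) (Fin 2) ℂ) (coeField U') - 1) c := by
      rw [Pi.sub_apply, ← hcoe, coeField_apply, Pi.one_apply]; rfl
    rw [e]
    refine (norm_le_pi_norm _ c).trans (hiter.trans ?_)
    nlinarith
  have hτ : 0 < 2 * (Kτ + 1) * δ := by positivity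
  have hX1 := (hXc.differentiableAt two_ne_zero).hasFDerivAt
  -- ### assemble the tail
  refine ⟨fderiv ℝ (fderiv ℝ (msChart F 2 Kt k (Bj ν.M₁ Z k) (avgFamily (avOfRecord F 2 Kt) (qsstarGIter0 k (ext Vk))) U₀)) 0, lam, p,
    fderiv ℝ (msChart F 2 Kt k (Bj ν.M₁ Z k) (avgFamily (avOfRecord F 2 Kt) (1 : GaugeField (F.P Kt) 0 SU2)) (1 : GaugeField (F.P Kt) 0 SU2)) 0,
    fun v => Hf v, hΨ₂, hΨd, hlam, hp, hHf, hρf, fun X => ⟨hδ₂w _, ?_, ?_, ?_⟩⟩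
  · -- (μ): `D²Ψ(0)(x,x)` has no level-0 component, so the multiplier bound on level-0-free data applies; then the curvature bound
    have hv0 := fun c (hc : c ∈ bondsOf (Bj ν.M₁ Z k 0)) =>
      fderiv_fderiv_msChart_apply_levelZero hUfib hΨd hΨ₂.differentiableAt c hc (fderiv ℝ Xf 0 X) (fderiv ℝ Xf 0 X)
    have h := (le_abs_self _).trans ((hlamv _ hv0).trans (mul_le_mul_of_nonneg_left (hcurv (fderiv ℝ Xf 0 X)) (mul_nonneg hj0 (by positivity))))
    refine h.trans (le_of_eq ?_)
    ring
  · -- (K) from the per-bond velocity bound and the support letter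
    have ha : 0 ≤ 12 * 𝓐₀ / R * ‖X‖ := by positivity
    have h := l2Seminorm_le_of_bound_of_support (N := 2) (maxDomT ν.M₁ Z 1) (fderiv ℝ Xf 0 X) ha (fun b => (hKb X b).2) (fun b hb => hsupp X b hb)
    calc p (fderiv ℝ Xf 0 X) ≤ Real.sqrt (Nat.card {b : PBond (F.P Kt) 0 // b.src ∈ maxDomT ν.M₁ Z 1}) * (12 * 𝓐₀ / R * ‖X‖) := h
      _ = (12 * 𝓐₀ / R * Real.sqrt (Nat.card {b : PBond (F.P Kt) 0 // b.src ∈ maxDomT ν.M₁ Z 1})) * ‖X‖ := by ring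
  · -- the Federbush clause at the curved chart, through the twist (Pauli coordinates eliminated in term mode, as in p630404)
    exact exists_lieSU2Coord.elim fun φ hφ =>
      exists_m_hm_twisted_window_of_isMinimizer_family h0 hk Z X (fun κ => lo κ - 2) hbox hφ hΩw
        (regMSCoPOfRecord F 2 ν Kt k (maxDomT ν.M₁ Z)) (ext Vk) U₀ hX₀ hmin hX1 hΨ hτ hW

end Main

end Summit.QuantumFields.YangMills.BalabanUVNodes.N12NearFlatChartLetterN

end
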